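import Summits.Ventures.YMGap.Conjectures.StrongCouplingSUNChiralLRO
import HarnessLib
import HarnessLib.Audit.Tags

/-!
# The `β`-dressed meson weight of the `SU(N)` theory (`N` odd, all-antiperiodic torus): the un-normalised
# functional `J_β`, chiral positivity at every gauge field, the dictionary

Cell `pub-ymgap`, seat qcd-lit g26 (literature-prover), `bears_on: Q1` (what the `SU(N)` extension of
Salmhofer–Seiler §5 p. 424 needs at `β > 0`).  Everything is a theorem (0 facts, 0 sorry).  This is the
`β ≥ 0` twin of `…SUNChiralLROMesonWeight` (there `β = 0`), following `…ChiralLROSchwingerDysonSetup` /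
`…ChiralLROMesonWeight` of the `U(N)` chain:

* `suJB β G = ∫ e^{−βS_W(V)} ∫dψ̄dψ G e^{−S_F(V)} ∏dV` (`SU(N)` links, Wilson plaquette weight in the
  defining representation, massless all-antiperiodic staggered action), linear in `G`; `suJB 0 = suJ`.
* POSITIVITY AT EVERY GAUGE FIELD: with the chiral sign `s` of `StaggeredChiralSwapPositivity`,
  `s ∫dψ̄dψ G e^{−S_F(V)} ≥ 0` for every `V ∈ SU(N)^{links}` and `G` in the chiral cone
  (`chiralSign_mul_berezin_fBSU` — the tree's pointwise positivity holds for any real link signs and any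
  `U(N)`-valued links), hence `s·J_β(G) = S_β(G) ≥ 0` (`chiralSign_mul_suJB_nonneg`).
* THE DICTIONARY: moments `w_β(m) = s·J_β(∏σ̂^m) ≥ 0`, weight `W_β` (`mesonWeightCSUB`),
  `[P·W_β]_{top} = s·J_β(P(σ̂))` (`bracketW_mesonWeightCSUB`), kernel
  `suTwoPointB β x y = Re J_β(ψ̄ψ(x)ψ̄ψ(y))/J_β(1) = (2N)²[σ_xσ_y]_{W_β}/[1]_{W_β}`, `suTwoPointB 0 = suTwoPoint`.

Honest framing: finite even torus, every real `β`; `Z_β = J_β(1) ≠ 0` is NOT proved here (it is a hypothesis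
downstream where needed); nothing about the thermodynamic or continuum limit or the summit's `QCD` conjunct.

## References
* [SalmhoferSeiler1991] M. Salmhofer, E. Seiler, Commun. Math. Phys. 139 (1991) 395–432, §2 (2.2)–(2.4),
  (2.9)–(2.14), (2.20)–(2.21), Remark 3.2, (3.100), §5 p. 424.
* [MontvayMunster1994] I. Montvay, G. Münster, *Quantum Fields on a Lattice*, CUP 1994, §5.1.6 (5.120)–(5.121).
-/

noncomputable section

open MeasureTheory Finset MvPolynomial
open scoped ComplexConjugate BigOperators ComplexOrder
open Literature.MathematicalPhysics.QuantumFieldTheory (Site Edge GaugeConfig wilsonAction plaquetteHolonomy)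
open Literature.MathematicalPhysics.QuantumFieldTheory.WilsonRP
open Literature.MathematicalPhysics.QuantumLattice
open Literature.MathematicalPhysics.QuantumLattice.GrassmannAlgebra
open Literature.MathematicalPhysics.QuantumLattice.StrongCoupling
open Literature.MathematicalPhysics.QuantumLattice.StaggeredRP (thetaT posAlg posSites IsPosSite gaussCorrN HermSqCert)
open Literature.MathematicalPhysics.StatisticalMechanics
open Literature.MathematicalPhysics.StatisticalMechanics.ComplexSpin
open Literature.Barriers.CriticalPhenomena.NonGibbs
open Literature.Probability.LatticeModels (TorusSite)

namespace Summit.Ventures.YMGap.Conjectures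

namespace MesonWeightSU

open MesonWeight SchwingerDyson

variable {N ν L : ℕ} [NeZero ν] [NeZero L] [LinearOrder (TorusSite ν L)]

/-! ### The objects at `β ≥ 0`: plaquette weight, the un-normalised functional, its real form -/

variable (N ν L) in
/-- The `SU(N)` plaquette Boltzmann factor `e^{−β S_W(V)}` (Wilson action in the defining representation). [cite: SalmhoferSeiler1991, §2 (2.2)] -/
def plaqSU (β : ℝ) (V : GaugeConfig ν L (OneLink.SUN N)) : ℝ :=
  Real.exp (-β * wilsonAction (StaggeredRP.repMat (StaggeredRP.suRep N)) V)

omit [LinearOrder (TorusSite ν L)] [NeZero ν] in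
/-- `0 < e^{−βS_W}`. [cite: SalmhoferSeiler1991, §2 (2.2)] -/
theorem plaqSU_pos (β : ℝ) (V : GaugeConfig ν L (OneLink.SUN N)) : 0 < plaqSU N ν L β V := by
  unfold plaqSU; exact Real.exp_pos _

omit [LinearOrder (TorusSite ν L)] [NeZero ν] in
/-- `e^{−0·S_W} = 1`. [cite: SalmhoferSeiler1991, §2 (2.2)] -/
theorem plaqSU_zero (V : GaugeConfig ν L (OneLink.SUN N)) : plaqSU N ν L 0 V = 1 := by
  rw [plaqSU, neg_zero, zero_mul, Real.exp_zero]

omit [LinearOrder (TorusSite ν L)] [NeZero ν] in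
/-- The plaquette factor is continuous in the gauge field. [cite: SalmhoferSeiler1991, §2 (2.2), (2.12)] -/
theorem continuous_plaqSU (β : ℝ) : Continuous (plaqSU N ν L β) := by
  have hρ : Continuous (StaggeredRP.repMat (StaggeredRP.suRep N)) :=
    continuous_subtype_val.comp StaggeredRP.continuous_suRep
  have hS : Continuous (wilsonAction (d := ν) (L := L) (StaggeredRP.repMat (StaggeredRP.suRep N))) := by
    unfold wilsonAction
    refine continuous_finsetSum _ fun p _ => ?_
    have h1 : Continuous fun U : GaugeConfig ν L (OneLink.SUN N) => plaquetteHolonomy U p.1 p.2.1.1 p.2.1.2 := by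
      unfold plaquetteHolonomy; fun_prop
    exact continuous_const.sub (Complex.continuous_re.comp (hρ.comp h1).matrix_trace)
  unfold plaqSU
  exact Real.continuous_exp.comp (hS.const_mul (-β))

variable (N ν L) in
/-- **The un-normalised `SU(N)` functional at coupling `β`**: `J_β(G) = ∫ e^{−βS_W(V)} ∫dψ̄dψ G e^{−S_F(V)} ∏dV`
(massless, all-antiperiodic signs). [cite: SalmhoferSeiler1991, §2 (2.9)–(2.12)] -/
def suJB (β : ℝ) (G : FermiAlg (TorusSite ν L) N) : ℂ :=
  ∫ V, (plaqSU N ν L β V : ℂ) * berezin ℂ _ (G * fermiBoltzmannSU (torusLinks ν L) (apSigns ν L) 0 V)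
    ∂(gaugeMeasureSU N (TorusSite ν L × Fin ν))

variable (N ν L) in
/-- **The real form `S_β(G) = ∫ e^{−βS_W} · s ∫dψ̄dψ G e^{−S_F} ∏dV`** with the chiral sign `s` of the tree's
`StaggeredChiralSwapPositivity` (nonnegative on the chiral cone). [cite: MontvayMunster1994, §5.1.6 (5.120)–(5.121)] -/
def suSB (β : ℝ) (G : FermiAlg (TorusSite ν L) N) : ℝ :=
  ∫ V, plaqSU N ν L β V * (chiralSign (N := N) (evens ν L) *
    berezin ℂ _ (G * fermiBoltzmannSU (torusLinks ν L) (apSigns ν L) 0 V)).re ∂(gaugeMeasureSU N (TorusSite ν L × Fin ν))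

/-- At `β = 0`, `J_0 = J` of `…SUNChiralLROMesonWeight`. [cite: SalmhoferSeiler1991, §2 (2.9)] -/
theorem suJB_zero (hL : Even L) (G : FermiAlg (TorusSite ν L) N) : suJB N ν L 0 G = suJ N ν L G := by
  rw [suJB, suJ_eq_integral (StaggeredRP.one_lt_of_even_neZero hL)]
  exact integral_congr_ae (ae_of_all _ fun V => by simp only [plaqSU_zero, Complex.ofReal_one, one_mul])

/-! ### Pointwise positivity (every gauge field) and regularity -/

omit [NeZero L] [LinearOrder (TorusSite ν L)] in
/-- The all-antiperiodic signs are real. [cite: SalmhoferSeiler1991, §2 (2.4)] -/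
theorem conj_apSigns (b : TorusSite ν L × Fin ν) : conj (apSigns ν L b) = apSigns ν L b := by
  rcases apSigns_eq_or b with h | h <;> simp [h]

/-- **`s ∫dψ̄dψ G e^{−S_F(V)} ≥ 0` and real, for EVERY `SU(N)` gauge field**, `G` in the chiral cone (the tree's
pointwise chiral-swap positivity, for the torus links and real signs). [cite: MontvayMunster1994, §5.1.6 (5.120)–(5.121)] -/
theorem chiralSign_mul_berezin_fBSU (hL : Even L) {G : FermiAlg (TorusSite ν L) N} (hG : IsChiralPositive (evens ν L) G)
    (V : GaugeConfig ν L (OneLink.SUN N)) :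
    0 ≤ (chiralSign (N := N) (evens ν L) * berezin ℂ _ (G * fermiBoltzmannSU (torusLinks ν L) (apSigns ν L) 0 V)).re ∧
      (chiralSign (N := N) (evens ν L) * berezin ℂ _ (G * fermiBoltzmannSU (torusLinks ν L) (apSigns ν L) 0 V)).im = 0 := by
  rw [fermiBoltzmannSU, fermiBoltzmann_zero_eq_grassmannExp_actionOn]
  exact chiralSign_mul_berezin_actionOn_nonneg _ _ (fst_mem_evens_iff hL) conj_apSigns _ hG

/-- `V ↦ e^{−βS_W(V)} ∫dψ̄dψ G e^{−S_F(V)}` is continuous. [cite: SalmhoferSeiler1991, §2 (2.12)] -/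
theorem continuous_integrand (hL : Even L) (β : ℝ) (G : FermiAlg (TorusSite ν L) N) :
    Continuous fun V : GaugeConfig ν L (OneLink.SUN N) =>
      (plaqSU N ν L β V : ℂ) * berezin ℂ _ (G * fermiBoltzmannSU (torusLinks ν L) (apSigns ν L) 0 V) :=
  (Complex.continuous_ofReal.comp (continuous_plaqSU β)).mul
    (continuous_apply_of_coeffContinuous ((CoeffContinuous.const G).mul
      (coeffContinuous_fermiBoltzmannSU _ (torusLinks_ne (StaggeredRP.one_lt_of_even_neZero hL)) _ _)) _)

omit [LinearOrder (TorusSite ν L)] [NeZero ν] in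
/-- Continuous functions of the `SU(N)` gauge field are `∏dV`-integrable. [cite: SalmhoferSeiler1991, §2 (2.12)] -/
theorem integrable_of_continuous_SU {E : Type*} [NormedAddCommGroup E] {f : GaugeConfig ν L (OneLink.SUN N) → E}
    (hf : Continuous f) : Integrable f (gaugeMeasureSU N (TorusSite ν L × Fin ν)) := by
  haveI : SecondCountableTopology (OneLink.SUN N) := by
    haveI : SecondCountableTopology (Matrix (Fin N) (Fin N) ℂ) :=
      inferInstanceAs (SecondCountableTopology (Fin N → Fin N → ℂ))
    exact TopologicalSpace.Subtype.secondCountableTopology _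
  haveI : IsFiniteMeasure (gaugeMeasureSU N (TorusSite ν L × Fin ν)) := by unfold gaugeMeasureSU; infer_instance
  exact hf.integrable_of_hasCompactSupport (HasCompactSupport.of_compactSpace f)

/-- The integrand of `J_β(G)` is integrable. [cite: SalmhoferSeiler1991, §2 (2.12)] -/
theorem integrable_suJB (hL : Even L) (β : ℝ) (G : FermiAlg (TorusSite ν L) N) :
    Integrable (fun V : GaugeConfig ν L (OneLink.SUN N) =>
      (plaqSU N ν L β V : ℂ) * berezin ℂ _ (G * fermiBoltzmannSU (torusLinks ν L) (apSigns ν L) 0 V))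
      (gaugeMeasureSU N (TorusSite ν L × Fin ν)) :=
  integrable_of_continuous_SU (continuous_integrand hL β G)

/-! ### Linearity of `J_β` -/

/-- `J_β` is additive. [cite: SalmhoferSeiler1991, §2 (2.9)–(2.10)] -/
theorem suJB_add (hL : Even L) (β : ℝ) (G G' : FermiAlg (TorusSite ν L) N) :
    suJB N ν L β (G + G') = suJB N ν L β G + suJB N ν L β G' := by
  rw [suJB, suJB, suJB, ← integral_add (integrable_suJB hL β G) (integrable_suJB hL β G')]
  refine integral_congr_ae (ae_of_all _ fun V => ?_)
  simp only [add_mul, map_add, mul_add]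

/-- `J_β` is homogeneous. [cite: SalmhoferSeiler1991, §2 (2.9)–(2.10)] -/
theorem suJB_smul (β : ℝ) (a : ℂ) (G : FermiAlg (TorusSite ν L) N) : suJB N ν L β (a • G) = a * suJB N ν L β G := by
  rw [suJB, suJB, ← integral_const_mul]
  refine integral_congr_ae (ae_of_all _ fun V => ?_)
  simp only [smul_mul_assoc, map_smul, smul_eq_mul]
  ring

/-- `J_β(0) = 0`. [cite: SalmhoferSeiler1991, §2 (2.9)–(2.10)] -/
theorem suJB_zero_arg (β : ℝ) : suJB N ν L β (0 : FermiAlg (TorusSite ν L) N) = 0 := by simp [suJB]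

/-- `J_β(∑ G_a) = ∑ J_β(G_a)`. [cite: SalmhoferSeiler1991, §2 (2.9)–(2.10)] -/
theorem suJB_sum (hL : Even L) (β : ℝ) {α : Type*} (s : Finset α) (G : α → FermiAlg (TorusSite ν L) N) :
    suJB N ν L β (∑ a ∈ s, G a) = ∑ a ∈ s, suJB N ν L β (G a) := by
  classical
  induction s using Finset.induction_on with
  | empty => simp [suJB_zero_arg]
  | insert a s ha ih => rw [Finset.sum_insert ha, Finset.sum_insert ha, suJB_add hL, ih]

/-! ### `s · J_β = S_β ≥ 0` on the chiral cone -/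

/-- `s · J_β(G) = S_β(G)` for `G` in the chiral cone. [cite: MontvayMunster1994, §5.1.6 (5.120)–(5.121)] -/
theorem chiralSign_mul_suJB (hL : Even L) (β : ℝ) {G : FermiAlg (TorusSite ν L) N} (hG : IsChiralPositive (evens ν L) G) :
    chiralSign (N := N) (evens ν L) * suJB N ν L β G = (suSB N ν L β G : ℂ) := by
  rw [suJB, suSB, ← integral_const_mul, ← integral_complex_ofReal]
  refine integral_congr_ae (ae_of_all _ fun V => ?_)
  obtain ⟨_, him⟩ := chiralSign_mul_berezin_fBSU hL hG V
  dsimp only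
  rw [mul_left_comm, Complex.ofReal_mul, ← Complex.re_add_im (chiralSign (N := N) (evens ν L) * berezin ℂ _ _), him]
  simp

/-- `S_β(G) ≥ 0` on the chiral cone. [cite: MontvayMunster1994, §5.1.6 (5.120)–(5.121)] -/
theorem suSB_nonneg (hL : Even L) (β : ℝ) {G : FermiAlg (TorusSite ν L) N} (hG : IsChiralPositive (evens ν L) G) :
    0 ≤ suSB N ν L β G :=
  integral_nonneg fun V => mul_nonneg (plaqSU_pos β V).le (chiralSign_mul_berezin_fBSU hL hG V).1

/-- **`s · J_β(G) ≥ 0`** for `G` in the chiral cone. [cite: MontvayMunster1994, §5.1.6 (5.120)–(5.121)] -/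
theorem chiralSign_mul_suJB_nonneg (hL : Even L) (β : ℝ) {G : FermiAlg (TorusSite ν L) N}
    (hG : IsChiralPositive (evens ν L) G) : 0 ≤ chiralSign (N := N) (evens ν L) * suJB N ν L β G := by
  rw [chiralSign_mul_suJB hL β hG]
  exact Complex.zero_le_real.2 (suSB_nonneg hL β hG)

/-- `s · Z_β ≥ 0`. [cite: SalmhoferSeiler1991, §2 (2.9)] -/
theorem chiralSign_mul_suJB_one_nonneg (hL : Even L) (β : ℝ) :
    0 ≤ chiralSign (N := N) (evens ν L) * suJB N ν L β 1 := chiralSign_mul_suJB_nonneg hL β IsChiralPositive.one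

/-- **Positivity transfer** (given `Z_β ≠ 0`): `0 ≤ J_β(G)/J_β(1)` implies `0 ≤ s · J_β(G)`. [cite: SalmhoferSeiler1991, §2 (2.9)–(2.11)] -/
theorem chiralSign_mul_suJB_nonneg_of_div (hL : Even L) (β : ℝ) (hZ : suJB N ν L β 1 ≠ 0)
    {G : FermiAlg (TorusSite ν L) N} (hG : 0 ≤ suJB N ν L β G / suJB N ν L β 1) :
    0 ≤ chiralSign (N := N) (evens ν L) * suJB N ν L β G := by
  have hkey : chiralSign (N := N) (evens ν L) * suJB N ν L β G =
      suJB N ν L β G / suJB N ν L β 1 * (chiralSign (N := N) (evens ν L) * suJB N ν L β 1) := by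
    field_simp
  rw [hkey]
  exact mul_nonneg hG (chiralSign_mul_suJB_one_nonneg hL β)

/-! ### The meson moments and the `β`-dressed meson weight -/

variable (N ν L) in
/-- **The meson moments at coupling `β`**: `w_β(m) = s · J_β(∏_x σ̂_x^{m_x})`. [cite: SalmhoferSeiler1991, §2 (2.9)–(2.10), (2.20)] -/
def mesonMomentSUB (β : ℝ) (m : TorusSite ν L →₀ ℕ) : ℂ :=
  chiralSign (N := N) (evens ν L) * suJB N ν L β (bos N (monomial m 1))

/-- Moments with an exponent `> N` vanish. [cite: SalmhoferSeiler1991, §2 (2.20)] -/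
theorem mesonMomentSUB_eq_zero_of_not_le (β : ℝ) {m : TorusSite ν L →₀ ℕ} (hm : ¬ m ≤ topExponent N) :
    mesonMomentSUB N ν L β m = 0 := by
  rw [mesonMomentSUB, bos_monomial_eq_zero hm, suJB_zero_arg, mul_zero]

variable (N ν L) in
/-- The real moments `S_β(∏σ̂^m)`. [cite: SalmhoferSeiler1991, §2 (2.20)] -/
def mesonMomentRSUB (β : ℝ) (m : TorusSite ν L →₀ ℕ) : ℝ := suSB N ν L β (bos N (monomial m 1))

/-- The moments are the nonnegative reals `S_β(∏σ̂^m)`. [cite: MontvayMunster1994, §5.1.6 (5.120)–(5.121)] -/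
theorem mesonMomentSUB_eq_ofReal (hL : Even L) (β : ℝ) (m : TorusSite ν L →₀ ℕ) :
    mesonMomentSUB N ν L β m = ((mesonMomentRSUB N ν L β m : ℝ) : ℂ) :=
  chiralSign_mul_suJB hL β (isChiralPositive_bos_monomial m)

/-- The real moments are `≥ 0`. [cite: MontvayMunster1994, §5.1.6 (5.120)–(5.121)] -/
theorem mesonMomentRSUB_nonneg (hL : Even L) (β : ℝ) (m : TorusSite ν L →₀ ℕ) : 0 ≤ mesonMomentRSUB N ν L β m :=
  suSB_nonneg hL β (isChiralPositive_bos_monomial m)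

variable (N ν L) in
/-- **The `β`-dressed meson weight of the `SU(N)` theory** `W_β = ∑_{m+m'=(N,…,N)} w_β(m) σ^{m'}`. [cite: SalmhoferSeiler1991, Remark 3.2 and §2 (2.20)] -/
def mesonWeightCSUB (β : ℝ) : FieldAlg ν L :=
  ∑ p ∈ Finset.HasAntidiagonal.antidiagonal (topExponent (ν := ν) (L := L) N), monomial p.2 (mesonMomentSUB N ν L β p.1)

/-- The bracket of a monomial: `[a σ^m]_{W_β} = a · w_β(m)`. [cite: SalmhoferSeiler1991, Remark 3.2] -/
theorem bracketW_mesonWeightCSUB_monomial (β : ℝ) (m : TorusSite ν L →₀ ℕ) (a : ℂ) :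
    bracketW N (mesonWeightCSUB N ν L β) (monomial m a) = a * mesonMomentSUB N ν L β m := by
  classical
  rw [bracketW, mesonWeightCSUB, Finset.mul_sum, coeff_sum]
  simp only [monomial_mul, coeff_monomial]
  have hiff : ∀ p ∈ Finset.HasAntidiagonal.antidiagonal (topExponent (ν := ν) (L := L) N),
      (m + p.2 = topExponent N ↔ p.1 = m) := by
    intro p hp
    rw [Finset.HasAntidiagonal.mem_antidiagonal] at hp
    constructor
    · intro h; exact add_right_cancel (hp.trans h.symm)
    · intro h; rw [← h]; exact hp
  rw [Finset.sum_congr rfl fun p hp => by rw [if_congr (hiff p hp) rfl rfl]]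
  by_cases hle : m ≤ topExponent N
  · rw [Finset.sum_eq_single_of_mem (m, topExponent N - m)]
    · rw [if_pos rfl]
    · rw [Finset.HasAntidiagonal.mem_antidiagonal]; exact add_tsub_cancel_of_le hle
    · intro p hp hpm
      rw [if_neg]
      intro h
      apply hpm
      rw [Finset.HasAntidiagonal.mem_antidiagonal] at hp
      have h2 : p.2 = topExponent N - m := by
        rw [← h]; exact eq_tsub_of_add_eq (by rw [add_comm]; exact hp)
      exact Prod.ext h h2
  · rw [Finset.sum_eq_zero, mesonMomentSUB_eq_zero_of_not_le β hle, mul_zero]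
    intro p hp
    rw [if_neg]
    intro h
    apply hle
    rw [Finset.HasAntidiagonal.mem_antidiagonal] at hp
    rw [← h, ← hp]
    exact le_self_add

/-- **THE DICTIONARY at coupling `β`**: `[P · W_β]_{(N,…,N)} = s · J_β(P(σ̂))`. [cite: SalmhoferSeiler1991, Remark 3.2 and §2 (2.20)–(2.21)] -/
theorem bracketW_mesonWeightCSUB (hL : Even L) (β : ℝ) (P : FieldAlg ν L) :
    bracketW N (mesonWeightCSUB N ν L β) P = chiralSign (N := N) (evens ν L) * suJB N ν L β (bos N P) := by
  conv_lhs => rw [P.as_sum, bracketW_sum]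
  conv_rhs => rw [P.as_sum, bos_sum, suJB_sum hL, Finset.mul_sum]
  refine Finset.sum_congr rfl fun m _ => ?_
  rw [bracketW_mesonWeightCSUB_monomial, mesonMomentSUB, show monomial m (coeff m P) = coeff m P • monomial m (1 : ℂ) by
    rw [smul_monomial, smul_eq_mul, mul_one], bos_smul, suJB_smul]
  ring

variable (N ν L) in
/-- The real `β`-dressed meson weight. [cite: SalmhoferSeiler1991, Remark 3.2 and §2 (2.20)] -/
def mesonWeightSUB (β : ℝ) : MvPolynomial (TorusSite ν L) ℝ :=
  ∑ p ∈ Finset.HasAntidiagonal.antidiagonal (topExponent (ν := ν) (L := L) N), monomial p.2 (mesonMomentRSUB N ν L β p.1)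

/-- Its complexification is `W_β`. [cite: SalmhoferSeiler1991, Remark 3.2] -/
theorem map_mesonWeightSUB (hL : Even L) (β : ℝ) :
    MvPolynomial.map Complex.ofRealHom (mesonWeightSUB N ν L β) = mesonWeightCSUB N ν L β := by
  rw [mesonWeightSUB, mesonWeightCSUB, map_sum]
  refine Finset.sum_congr rfl fun p _ => ?_
  rw [map_monomial, mesonMomentSUB_eq_ofReal hL]
  rfl

/-- `[P]_{W_β} = s·J_β(P(σ̂))` for real `P`. [cite: SalmhoferSeiler1991, Remark 3.2 and §2 (2.20)–(2.21)] -/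
theorem bracketWR_mesonWeightSUB (hL : Even L) (β : ℝ) (P : MvPolynomial (TorusSite ν L) ℝ) :
    ((bracketWR N (mesonWeightSUB N ν L β) P : ℝ) : ℂ) =
      chiralSign (N := N) (evens ν L) * suJB N ν L β (bos N (MvPolynomial.map Complex.ofRealHom P)) := by
  rw [← bracketW_map_map, map_mesonWeightSUB hL, bracketW_mesonWeightCSUB hL]

/-- `[1]_{W_β} = s · Z_β`. [cite: SalmhoferSeiler1991, §2 (2.9)] -/
theorem bracketWR_mesonWeightSUB_one (hL : Even L) (β : ℝ) :
    ((bracketWR N (mesonWeightSUB N ν L β) 1 : ℝ) : ℂ) = chiralSign (N := N) (evens ν L) * suJB N ν L β 1 := by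
  rw [bracketWR_mesonWeightSUB hL, map_one, bos_one]

/-- `[1]_{W_β} ≥ 0`. [cite: SalmhoferSeiler1991, §2 (2.11)] -/
theorem bracketWR_mesonWeightSUB_one_nonneg (hL : Even L) (β : ℝ) : 0 ≤ bracketWR N (mesonWeightSUB N ν L β) 1 := by
  have h := chiralSign_mul_suJB_one_nonneg (N := N) (ν := ν) hL β
  rw [← bracketWR_mesonWeightSUB_one hL] at h
  exact_mod_cast h

/-- **The two-point kernel of `W_β`**: `[σ_xσ_y]_{W_β} = (2N)⁻² s·J_β(ψ̄ψ(x)ψ̄ψ(y))`. [cite: SalmhoferSeiler1991, (3.100) and §2 (2.14)] -/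
theorem twoPtWR_mesonWeightSUB (hL : Even L) (β : ℝ) (x y : TorusSite ν L) :
    ((twoPtWR N (mesonWeightSUB N ν L β) x y : ℝ) : ℂ) =
      (((spinScale N ^ 2 : ℝ)) : ℂ) * (chiralSign (N := N) (evens ν L) * suJB N ν L β (meson x * meson y)) := by
  rw [twoPtWR, bracketWR_mesonWeightSUB hL, map_mul, map_X, map_X, bos_X_mul_X', suJB_smul]
  ring

/-! ### The two-point function and the order parameter at coupling `β` -/

variable (N ν L) in
/-- **The chiral two-point function at coupling `β`**: `T_β(x,y) = Re (J_β(ψ̄ψ(x)ψ̄ψ(y)) / J_β(1))` (the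
normalised coupled expectation; the pure-gauge normalisation cancels). [cite: SalmhoferSeiler1991, (3.100), §2 (2.10)] -/
def suTwoPointB (β : ℝ) (x y : TorusSite ν L) : ℝ := (suJB N ν L β (meson x * meson y) / suJB N ν L β 1).re

variable (N ν L) in
/-- The order parameter `|Λ|⁻¹ ∑_x T_β(0,x)`. [cite: SalmhoferSeiler1991, Thm 4.8 (4.41)–(4.42)] -/
def suChiralOrderB (β : ℝ) : ℝ := ((L : ℝ) ^ ν)⁻¹ * ∑ x : TorusSite ν L, suTwoPointB N ν L β 0 x

/-- **The kernel through the weight**: `J_β(ψ̄ψψ̄ψ)/J_β(1) = (2N)² [σ_xσ_y]_{W_β} / [1]_{W_β}`. [cite: SalmhoferSeiler1991, §2 (2.14), (2.20)–(2.21)] -/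
theorem suJB_meson_div_eq (hN : N ≠ 0) (hL : Even L) (β : ℝ) (x y : TorusSite ν L) :
    suJB N ν L β (meson x * meson y) / suJB N ν L β 1 =
      (((2 * N : ℝ) ^ 2 * twoPtWR N (mesonWeightSUB N ν L β) x y / bracketWR N (mesonWeightSUB N ν L β) 1 : ℝ) : ℂ) := by
  have hs : chiralSign (N := N) (evens ν L) ≠ 0 := fun h0 => by
    have := chiralSign_mul_self (N := N) (evens ν L); rw [h0, zero_mul] at this; exact zero_ne_one this
  have hN0 : (N : ℂ) ≠ 0 := by exact_mod_cast hN
  push_cast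
  rw [twoPtWR_mesonWeightSUB hL, bracketWR_mesonWeightSUB_one hL]
  by_cases hZ : suJB N ν L β 1 = 0
  · rw [hZ]; simp
  unfold spinScale
  push_cast
  field_simp

/-- The normalised two-point expectation is real. [cite: SalmhoferSeiler1991, (3.100)] -/
theorem suJB_meson_div_eq_ofReal (hN : N ≠ 0) (hL : Even L) (β : ℝ) (x y : TorusSite ν L) :
    suJB N ν L β (meson x * meson y) / suJB N ν L β 1 = ((suTwoPointB N ν L β x y : ℝ) : ℂ) := by
  rw [suTwoPointB, suJB_meson_div_eq hN hL, Complex.ofReal_re]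

/-- `T_β(x,y) = (2N)² [σ_xσ_y]_{W_β} / [1]_{W_β}`. [cite: SalmhoferSeiler1991, §2 (2.14), (2.20)–(2.21)] -/
theorem suTwoPointB_eq_twoPtWR_div (hN : N ≠ 0) (hL : Even L) (β : ℝ) (x y : TorusSite ν L) :
    suTwoPointB N ν L β x y =
      (2 * N : ℝ) ^ 2 * twoPtWR N (mesonWeightSUB N ν L β) x y / bracketWR N (mesonWeightSUB N ν L β) 1 := by
  rw [suTwoPointB, suJB_meson_div_eq hN hL, Complex.ofReal_re]

/-- **Symmetry**: `T_β(x,y) = T_β(y,x)`. [cite: SalmhoferSeiler1991, (3.100)] -/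
theorem suTwoPointB_comm (β : ℝ) (x y : TorusSite ν L) : suTwoPointB N ν L β x y = suTwoPointB N ν L β y x := by
  rw [suTwoPointB, suTwoPointB, (commute_meson x (meson y)).eq]

/-- At `β = 0` the kernel is that of `…SUNChiralLROMesonWeight`. [cite: SalmhoferSeiler1991, §2 (2.10)] -/
theorem suTwoPointB_zero (hL : Even L) (x y : TorusSite ν L) : suTwoPointB N ν L 0 x y = suTwoPoint N ν L x y := by
  rw [suTwoPointB, suTwoPoint, fermiExpectSU_const_eq, suJB_zero hL, suJB_zero hL]

end MesonWeightSU

end Summit.Ventures.YMGap.Conjectures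

end
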